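import Summits.ABC.StewartYu.SatBasisReducedTri
import HarnessLib

/-!
# The TRIANGULAR reduced saturated basis (II) — the WEIGHT-SORTED (lower-triangular) frame `exists_reduced_satFrame_lower`

Support file (theorems only; no named facts, no definitions). Cell `abc-stewartyu`, route `YuMatveevShapeRat` (A1.L), crux r2 `ArchCoreRat`
(stmt-ABC-20502); seat p5 g9. Sequel of `SatBasisReducedTri` (`exists_reduced_satFrame_upper`): the frame is applied to the reversed datum
`α ∘ Fin.rev` and un-reversed (`Matrix.submatrix Fin.rev Fin.rev`), so that in the datum's own (weight-increasing, `Monotone A`) indexing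
`θₖ^N = ∏ⱼ αⱼ^{Uₖⱼ}` with `Uₖⱼ = 0` for `k < j` (θₖ involves only the LIGHTER generators `α₀,…,αₖ`), `0 < Uₖₖ`, and — by
`lower_of_mul_eq_smul_one` (`U·C = N·1`, `U` lower-triangular with positive diagonal ⇒ `C` lower-triangular, `Uₖₖ·Cₖₖ = N`, `0 < Cₖₖ`) —
`αⱼ = ∏ₖ θₖ^{Cⱼₖ}` with `Cⱼₖ = 0` for `j < k`; together with every conclusion of p1's `exists_reduced_satFrame`. This is the basis shape the
archimedean letter lines need (STATUS 2026-08-27 ~20:58Z: the θ-charged atoms `Σₖ Aₖ·Γₖ`, `YC` are then `≤ poly(n!)·N²·B·L`, weight-free).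

WHAT THIS IS NOT: no change to `SatBasisReduced`/`LatticeReducedRows`; no START; no crux moves.

## References
* [Cassels1997] J. W. S. Cassels, *An Introduction to the Geometry of Numbers*, Ch. I §2.2 Thm I (triangular bases of a lattice).
* [Nesterenko2003] Yu. V. Nesterenko, LNM 1819 (2003) — §3.4–3.5 (the lattice `𝔑` and its basis), §2 (weights sorted `A₁ ≤ … ≤ Aₙ`).
-/

namespace Summit.ABC.StewartYu

namespace SatBasisReduced

open Finset Matrix
open scoped Nat

variable {n : ℕ}

/-! ### Triangular `U` ⇒ triangular `C` -/

/-- **Lower-triangular `U` with positive diagonal and `U·C = N·1` ⇒ `C` lower-triangular, `Uₖₖ·Cₖₖ = N`, `0 < Cₖₖ`** (`N ≥ 1`).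
[folklore] -/
theorem lower_of_mul_eq_smul_one {N : ℕ} (hN : 0 < N) {U C : Matrix (Fin n) (Fin n) ℤ}
    (hUC : U * C = (N : ℤ) • (1 : Matrix (Fin n) (Fin n) ℤ))
    (htri : ∀ k j : Fin n, k < j → U k j = 0) (hdiag : ∀ k, 0 < U k k) :
    (∀ j k : Fin n, j < k → C j k = 0) ∧ (∀ k, U k k * C k k = N) ∧ (∀ k, 0 < C k k) := by
  classical
  have hentry : ∀ i k, ∑ j, U i j * C j k = if i = k then (N : ℤ) else 0 := by
    intro i k
    have h := congrFun (congrFun hUC i) k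
    rw [Matrix.mul_apply] at h
    rw [h, Matrix.smul_apply, Matrix.one_apply]
    split_ifs <;> simp
  -- triangularity of `C` by strong induction on the row index
  have hCtri : ∀ m : ℕ, ∀ i : Fin n, (i : ℕ) = m → ∀ k : Fin n, i < k → C i k = 0 := by
    intro m
    induction m using Nat.strong_induction_on with
    | _ m ih =>
      intro i hi k hik
      have h := hentry i k
      rw [if_neg (ne_of_lt hik)] at h
      -- split the sum at `j = i`: terms `j < i` vanish by induction (`C j k = 0`), terms `j > i` by `U i j = 0`
      have hsum : ∑ j, U i j * C j k = U i i * C i k := by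
        rw [← Finset.sum_erase_add _ _ (Finset.mem_univ i)]
        have h0 : ∑ j ∈ (Finset.univ : Finset (Fin n)).erase i, U i j * C j k = 0 := by
          refine Finset.sum_eq_zero fun j hj => ?_
          rcases lt_or_gt_of_ne (Finset.ne_of_mem_erase hj) with hji | hij
          · rw [ih j (by omega) j rfl k (lt_trans hji hik), mul_zero]
          · rw [htri i j hij, zero_mul]
        rw [h0, zero_add]
      rw [hsum] at h
      rcases mul_eq_zero.mp h with h1 | h1
      · exact absurd h1 (hdiag i).ne'
      · exact h1
  have hCtri' : ∀ j k : Fin n, j < k → C j k = 0 := fun j k hjk => hCtri j j rfl k hjk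
  have hdiagC : ∀ k, U k k * C k k = N := by
    intro k
    have h := hentry k k
    rw [if_pos rfl] at h
    rw [← h, ← Finset.sum_erase_add _ _ (Finset.mem_univ k)]
    have h0 : ∑ j ∈ (Finset.univ : Finset (Fin n)).erase k, U k j * C j k = 0 := by
      refine Finset.sum_eq_zero fun j hj => ?_
      rcases lt_or_gt_of_ne (Finset.ne_of_mem_erase hj) with hjk | hkj
      · rw [hCtri' j k hjk, mul_zero]
      · rw [htri k j hkj, zero_mul]
    rw [h0, zero_add]
  refine ⟨hCtri', hdiagC, fun k => ?_⟩
  have h := hdiagC k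
  have hN' : (0 : ℤ) < N := by exact_mod_cast hN
  rcases lt_trichotomy (C k k) 0 with hc | hc | hc
  · exfalso; have := mul_neg_of_pos_of_neg (hdiag k) hc; linarith
  · exfalso; rw [hc, mul_zero] at h; linarith
  · exact hc

/-! ### The weight-sorted (lower-triangular) frame -/

/-- reindexing a product by `Fin.rev`. [folklore] -/
theorem prod_comp_rev {M : Type*} [CommMonoid M] (f : Fin n → M) : ∏ i, f (Fin.rev i) = ∏ i, f i :=
  Equiv.prod_comp Fin.revPerm f

/-- reindexing a sum by `Fin.rev`. [folklore] -/
theorem sum_comp_rev {M : Type*} [AddCommMonoid M] (f : Fin n → M) : ∑ i, f (Fin.rev i) = ∑ i, f i :=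
  Equiv.sum_comp Fin.revPerm f

/-- `∏ᵢ g(rev i)^{c i} = ∏ᵢ g i^{c (rev i)}`. [folklore] -/
theorem prod_zpow_rev (g : Fin n → ℚ) (c : Fin n → ℤ) : ∏ i, g (Fin.rev i) ^ c i = ∏ i, g i ^ c (Fin.rev i) := by
  rw [← prod_comp_rev (fun i => g i ^ c (Fin.rev i))]
  simp only [Fin.rev_rev]

/-- **THE WEIGHT-SORTED REDUCED SATURATION FRAME (lower-triangular).** For positive multiplicatively independent rationals `α₀,…,α_{n−1}`
(in the datum's indexing, intended weight-increasing): all conclusions of `exists_reduced_satFrame`, and moreover `Uₖⱼ = 0` for `k < j`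
(θₖ^N involves only `α₀,…,αₖ`), `0 < Uₖₖ`, `Cⱼₖ = 0` for `j < k` (αⱼ involves only `θ₀,…,θⱼ`), `Uₖₖ·Cₖₖ = N`, `0 < Cₖₖ`.
[cite: Nesterenko2003, §3.4–3.5 and §4.3 Cor 4.5; Cassels1997, Ch. I §2.2] -/
theorem exists_reduced_satFrame_lower (α : Fin n → ℚ) (hα : ∀ j, 0 < α j)
    (hind : ∀ μ : Fin n → ℤ, ∏ j, α j ^ μ j = 1 → μ = 0) :
    ∃ (θ : Fin n → ℚ) (U C : Matrix (Fin n) (Fin n) ℤ) (N : ℕ),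
      (∀ i, 0 < θ i) ∧
      (∀ μ : Fin n → ℤ, ∏ i, θ i ^ μ i = 1 → μ = 0) ∧
      (∀ q : ℕ, 0 < q → ∀ γ : ℚ, (∃ c : Fin n → ℤ, γ ^ q = ∏ i, θ i ^ c i) →
        ∃ c : Fin n → ℤ, γ = ∏ i, θ i ^ c i ∨ -γ = ∏ i, θ i ^ c i) ∧
      (∀ κ : Fin n → ℤ, (∃ γ : ℚ, ∏ i, θ i ^ κ i = γ ^ 2 ∨ ∏ i, θ i ^ κ i = -γ ^ 2) →
        ∀ i, (2 : ℤ) ∣ κ i) ∧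
      0 < N ∧
      (∀ i, θ i ^ N = ∏ j, α j ^ U i j) ∧
      (∀ j, α j = ∏ i, θ i ^ C j i) ∧
      U * C = (N : ℤ) • (1 : Matrix (Fin n) (Fin n) ℤ) ∧
      C * U = (N : ℤ) • (1 : Matrix (Fin n) (Fin n) ℤ) ∧
      (N : ℤ) = |C.det| ∧
      (N : ℝ) ≤ ∏ j, (2 * Height.logHeight₁ (α j) / Real.log 2) ∧
      (∀ i j, 0 ≤ U i j ∧ U i j ≤ N) ∧
      (∀ j, ∑ i, |U i j| ≤ (n : ℤ) * N) ∧
      (∀ j k, |C j k| ≤ ((n - 1) ! : ℤ) * N) ∧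
      (∀ i, Height.logHeight₁ (θ i) ≤ ∑ j, Height.logHeight₁ (α j)) ∧
      (∀ p : ℕ, p.Prime → (∀ j, padicValRat p (α j) = 0) → ∀ i, padicValRat p (θ i) = 0) ∧
      (∀ k j : Fin n, k < j → U k j = 0) ∧ (∀ k, 0 < U k k) ∧
      (∀ j k : Fin n, j < k → C j k = 0) ∧ (∀ k, U k k * C k k = N) ∧ (∀ k, 0 < C k k) := by
  classical
  -- the reversed datum
  set αr : Fin n → ℚ := fun j => α (Fin.rev j) with hαr
  have hαr0 : ∀ j, 0 < αr j := fun j => hα _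
  have hindr : ∀ μ : Fin n → ℤ, ∏ j, αr j ^ μ j = 1 → μ = 0 := by
    intro μ hμ
    have h1 : ∏ j, α j ^ μ (Fin.rev j) = 1 := by rw [← prod_zpow_rev]; exact hμ
    have h2 := hind _ h1
    funext j
    have := congrFun h2 (Fin.rev j)
    simpa [Fin.rev_rev] using this
  obtain ⟨θr, Ur, Cr, N, hpos, hθind, hsat, hkum, hN, hU, hC, hUC, hCU, hdet, hNle, hbox, hcol, hCle, hht, hunit, htri, hdiag⟩ :=
    exists_reduced_satFrame_upper αr hαr0 hindr
  -- un-reverse: `θ := θr ∘ rev`, `U := Ur.submatrix rev rev`, `C := Cr.submatrix rev rev`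
  set θ : Fin n → ℚ := fun i => θr (Fin.rev i) with hθ
  set U : Matrix (Fin n) (Fin n) ℤ := Ur.submatrix Fin.rev Fin.rev with hUdef
  set C : Matrix (Fin n) (Fin n) ℤ := Cr.submatrix Fin.rev Fin.rev with hCdef
  have hUapp : ∀ i j, U i j = Ur (Fin.rev i) (Fin.rev j) := fun i j => rfl
  have hCapp : ∀ i j, C i j = Cr (Fin.rev i) (Fin.rev j) := fun i j => rfl
  -- `θ`-statements transfer through `prod_zpow_rev`
  have hθprod : ∀ c : Fin n → ℤ, ∏ i, θ i ^ c i = ∏ i, θr i ^ c (Fin.rev i) := fun c => prod_zpow_rev θr c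
  have hθind' : ∀ μ : Fin n → ℤ, ∏ i, θ i ^ μ i = 1 → μ = 0 := by
    intro μ hμ
    rw [hθprod] at hμ
    have h2 := hθind _ hμ
    funext j
    have := congrFun h2 (Fin.rev j)
    simpa [Fin.rev_rev] using this
  have hsat' : ∀ q : ℕ, 0 < q → ∀ γ : ℚ, (∃ c : Fin n → ℤ, γ ^ q = ∏ i, θ i ^ c i) →
      ∃ c : Fin n → ℤ, γ = ∏ i, θ i ^ c i ∨ -γ = ∏ i, θ i ^ c i := by
    rintro q hq γ ⟨c, hc⟩
    rw [hθprod] at hc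
    obtain ⟨c', hc'⟩ := hsat q hq γ ⟨_, hc⟩
    refine ⟨fun i => c' (Fin.rev i), ?_⟩
    rw [hθprod]
    simpa [Fin.rev_rev] using hc'
  have hkum' : ∀ κ : Fin n → ℤ, (∃ γ : ℚ, ∏ i, θ i ^ κ i = γ ^ 2 ∨ ∏ i, θ i ^ κ i = -γ ^ 2) →
      ∀ i, (2 : ℤ) ∣ κ i := by
    rintro κ ⟨γ, hγ⟩ i
    rw [hθprod] at hγ
    have h := hkum (fun i => κ (Fin.rev i)) ⟨γ, hγ⟩ (Fin.rev i)
    simpa [Fin.rev_rev] using h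
  have hU' : ∀ i, θ i ^ N = ∏ j, α j ^ U i j := by
    intro i
    show θr (Fin.rev i) ^ N = ∏ j, α j ^ Ur (Fin.rev i) (Fin.rev j)
    rw [hU (Fin.rev i), ← prod_comp_rev (fun j => α j ^ Ur (Fin.rev i) (Fin.rev j))]
    simp only [Fin.rev_rev, hαr]
  have hC' : ∀ j, α j = ∏ i, θ i ^ C j i := by
    intro j
    show α j = ∏ i, θr (Fin.rev i) ^ Cr (Fin.rev j) (Fin.rev i)
    have h := hC (Fin.rev j)
    simp only [hαr, Fin.rev_rev] at h
    rw [h, ← prod_comp_rev (fun i => θr i ^ Cr (Fin.rev j) i)]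
  have hUC' : U * C = (N : ℤ) • (1 : Matrix (Fin n) (Fin n) ℤ) := by
    rw [hUdef, hCdef, show (Fin.rev : Fin n → Fin n) = ⇑(Fin.revPerm : Equiv.Perm (Fin n)) from rfl,
      Matrix.submatrix_mul_equiv, hUC]
    ext i j
    simp only [Matrix.submatrix_apply, Matrix.smul_apply, Matrix.one_apply, EmbeddingLike.apply_eq_iff_eq]
  have hCU' : C * U = (N : ℤ) • (1 : Matrix (Fin n) (Fin n) ℤ) := by
    rw [hUdef, hCdef, show (Fin.rev : Fin n → Fin n) = ⇑(Fin.revPerm : Equiv.Perm (Fin n)) from rfl,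
      Matrix.submatrix_mul_equiv, hCU]
    ext i j
    simp only [Matrix.submatrix_apply, Matrix.smul_apply, Matrix.one_apply, EmbeddingLike.apply_eq_iff_eq]
  have hdet' : (N : ℤ) = |C.det| := by
    rw [hCdef, show (Fin.rev : Fin n → Fin n) = ⇑(Fin.revPerm : Equiv.Perm (Fin n)) from rfl, Matrix.det_submatrix_equiv_self]
    exact hdet
  have hNle' : (N : ℝ) ≤ ∏ j, (2 * Height.logHeight₁ (α j) / Real.log 2) := by
    rw [← prod_comp_rev (fun j => 2 * Height.logHeight₁ (α j) / Real.log 2)]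
    exact hNle
  have hbox' : ∀ i j, 0 ≤ U i j ∧ U i j ≤ N := fun i j => hbox _ _
  have hcol' : ∀ j, ∑ i, |U i j| ≤ (n : ℤ) * N := by
    intro j
    show ∑ i, |Ur (Fin.rev i) (Fin.rev j)| ≤ (n : ℤ) * N
    rw [sum_comp_rev (fun i => |Ur i (Fin.rev j)|)]
    exact hcol _
  have hCle' : ∀ j k, |C j k| ≤ ((n - 1) ! : ℤ) * N := fun j k => hCle _ _
  have hht' : ∀ i, Height.logHeight₁ (θ i) ≤ ∑ j, Height.logHeight₁ (α j) := by
    intro i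
    rw [← sum_comp_rev (fun j => Height.logHeight₁ (α j))]
    exact hht _
  have hunit' : ∀ p : ℕ, p.Prime → (∀ j, padicValRat p (α j) = 0) → ∀ i, padicValRat p (θ i) = 0 :=
    fun p hp h i => hunit p hp (fun j => h _) _
  have htri' : ∀ k j : Fin n, k < j → U k j = 0 := by
    intro k j hkj
    rw [hUapp]
    exact htri _ _ (by have := Fin.rev_lt_rev.mpr hkj; exact this)
  have hdiag' : ∀ k, 0 < U k k := fun k => hdiag _
  obtain ⟨hCtri, hdiagC, hCpos⟩ := lower_of_mul_eq_smul_one hN hUC' htri' hdiag'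
  exact ⟨θ, U, C, N, fun i => hpos _, hθind', hsat', hkum', hN, hU', hC', hUC', hCU', hdet', hNle', hbox', hcol', hCle', hht', hunit',
    htri', hdiag', hCtri, hdiagC, hCpos⟩

end SatBasisReduced

end Summit.ABC.StewartYu
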